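import Summits.HodgeConjecture.HodgeConjecture.Theorems.Ring2AbelianAllAndreWeilFieldPencils
import Summits.HodgeConjecture.HodgeConjecture.Theorems.Ring2AbelianAllAndreWeilFieldTypeTransport
import Literature.AlgebraicGeometry.HodgeTheory.WeilClassesTensorPointFieldLines
import HarnessLib

/-!
# Ring 2 · AbelianAll — ANDRÉ AXIS, PART R-d: ANCHORS FOR THE CM-FIELD ROWS — Deligne's tensor points `T ⊗ E` (UNCONDITIONAL: the anchor's
  Weil classes are algebraic for every number field `E` and every `T`), a member of Weil type + a member satisfying the Hodge conjecture, a CM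
  member under `HC_CM`; and the smallest new habitat typed: compact pencils of abelian EIGHTFOLDS with multiplication by a QUARTIC CM field,
  whose `E`-Weil classes have codimension 2 — `B⋆` of the ONE 9-fold total space through `T ⊗ E` (`T` an abelian surface) ⟹ they are algebraic
  on EVERY member

HONEST FRAMING (page 1, verbatim): **research route, not a corollary; conditional on HC_CM plus one named minimal statement.** Cell line:
research route conditional on HC_CM; not a corollary; Q11.4-sentence-2 already refuted in dim ≥ 3. Nothing in this file proves a case of the
Hodge conjecture (beyond the tree's tensor points) or of `B(X)` for a named `X`: the rows are IMPLICATIONS with displayed hypotheses. `HC_AV` and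
the global nodes do NOT occur; `HC_CM` (`Theses.RankFourFaces.CMAbelianHodge`) is the explicit HYPOTHESIS of §4 only, never a fact. Item
`Theses.RankFourFaces.CMToAbelian` (stmt-16267) stays OPEN; N104 untouched; no node is born (0 `def`, 0 `sorry`, no named fact). Seat
`pub-hodge-ring2-ab-andre-2`, gen 48 (part R: the André axis for CM fields). Inputs: part R-b (`B⋆` of the one total space + one anchored member
⟹ `W_E ⊗ ℂ` algebraic on every member; through an HC chart of Weil type), part R-c (Weil type relative to `E` is constant along the pencil), the
tree's UNCONDITIONAL tensor points (`weilClassesField_le_algebraicClasses_of_companion`: at a companion tensor structure `(T^{n+1}, φ)` of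
`P = x^{n+1} + Σ a_j x^j` over ANY abelian `T`, ALL of `weilClassesField` is algebraic — Deligne's Lemma 4.5 / Remark 4.10 in the kernel), and part
M-c's «a CM member satisfies HC granted `HC_CM`».

## Content (theorems only; standard axioms)

* §1 **`weilClassesField_le_algebraicClasses_forall_of_lefschetzB_of_companionTensorChart`** — UNCONDITIONAL ANCHOR (fact-free): compact pencil of
  abelian `d`-folds with `B⋆(𝒳, η) ∀η`, a global `E`-action (`Φ`; charts `(A_s, e_s, φ_s)` with `P(φ_s) = 0`, `P` irreducible of degree `e`,
  `e · 2g = 2d`), a rational global `U` on `W_E(A_t) ⊗ ℂ` with `U|X_t ≠ 0`, and ONE chart `(A_{s₀}, φ_{s₀})` carrying a companion tensor structure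
  over an abelian `g`-fold `T` (homomorphisms `q₀, …, q_n : A_{s₀} ⟶ T` with the companion relations of a monic integer polynomial with `n+1`
  distinct complex roots, a separating endomorphism, a section of `q₀`) ⟹ `W_E(A_s, φ_s) ⊗ ℂ ⊆ Nᵍ(A_s)` for EVERY member. No Hodge–Weil theorem in
  print, no `HC_CM`, no Verdier.
* §2 **`weilClassesField_le_algebraicClasses_forall_of_lefschetzB_of_quarticTensorChart`** — THE SMALLEST NEW HABITAT, typed: `n + 1 = 4`, `g = 2`:
  compact pencils of abelian EIGHTFOLDS with multiplication by a quartic field `E`, the `E`-Weil classes in `H⁴` (codimension 2): `B⋆` of the ONE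
  9-fold total space through a tensor chart `T ⊗ E`, `T` an abelian surface ⟹ the codimension-2 `E`-Weil classes of EVERY member are algebraic.
* §3 **`weilClassesField_le_algebraicClasses_forall_of_lefschetzB_of_weilTypeCM_of_hodgeConjectureFor_member`** — Weil type (CM) read at the
  member `t` carrying `U`, the Hodge conjecture at ANY member `s₀` (parts R-c + R-b §2).
* §4 **`weilClassesField_le_algebraicClasses_forall_of_lefschetzB_of_HC_CM_of_cmChart`** — THE SUMMIT'S SETTING: granted `HC_CM` (a HYPOTHESIS),
  through a chart of CM type (André's Lemme 6.3.1 pencils): `B⋆` of the one total space ⟹ `W_E ⊗ ℂ` algebraic on every member.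

## Honest status

§1–§2 exhibit UNCONDITIONAL anchors for the CM-field rows on the components containing a tensor point (the SPLIT `E`-Weil components, Deligne
Cor. 4.2 (b) / André's condition (*)); which non-split `E`-components (discriminant in `E⁺ˣ/N(Eˣ)`, signatures) contain a member with algebraic
`W_E` outright is NOT decided here (owed, (o156); the quadratic twisted squares of parts O–Q are the model). The habitat of §2 is open in print even
on the split components ([Andre2026, §4.4.4]: for `E⁺ ≠ ℚ` the Weil classes «are not known to be algebraic (nor Künneth-algebraic)»;
[Markman2025SurveySecant]: reduction to a variational statement). Existence of compact pencils with a global `E`-action through a tensor point and a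
given member is NOT constructed (for split `E`-Weil structures it is André's Lemme 6.3.3, the tree's named fact
`andre1996_splitWeilClasses_algebraicallyAnchoredPencil`, NOT used here). Nothing minimal claimed; N104 untouched.
EDGE LABELS: §1–§3 K (fact-free); §4 K with `HC_CM` as hypothesis.
References: Deligne1982HodgeCycles (§4 Lemma 4.5, Remark 4.10, Cor. 4.2, Prop. 4.4, proof of Thm. 4.8); MoonenZarhin1998WeilClasses (§1);
Andre1996Motifs (§6.3 Lemmes 6.3.1, 6.3.3, Remarque 2); Andre2026 (§4.4.4); Markman2025SurveySecant (§4, §11.5); Abdulali1994FamiliesAV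
((1.1), Thm. 5.5); Tankeev2008 (Thm. (i)–(ii)).
-/

noncomputable section

set_option linter.dupNamespace false

namespace Summit.HodgeConjecture.HodgeConjecture.Ring2.AbelianAll

open CategoryTheory CategoryTheory.Limits AlgebraicGeometry MonoidalCategory CartesianMonoidalCategory
open Literature.AlgebraicGeometry Literature.AlgebraicGeometry.Motives
open Literature.AlgebraicGeometry.HodgeTheory Literature.AlgebraicGeometry.Deligne1982
open Literature.AlgebraicGeometry.Milne1999 (IsOfCMType)
open Literature.AlgebraicTopology.SingularHomology (singularCohomology)
open Summit.HodgeConjecture.HodgeConjecture.Theses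

variable {𝒳 S : SchemeOver ℂ} {f : 𝒳 ⟶ S} {d : ℕ}

/-! ## §1 Unconditional anchor: a chart that is a companion tensor point `T ⊗ E` -/

section Tensor

variable {T : AbelianVariety ℂ} {g n : ℕ}

/-- **THROUGH A TENSOR POINT `T ⊗ E` — THE ANCHOR DISCHARGED (fact-free, unconditional at the anchor).** Compact pencil `f : 𝒳 ⟶ S` of abelian
`d`-folds with `B⋆(𝒳, η) ∀η`, a global endomorphism `Φ` over `S`, charts `(A_s, e_s, φ_s)` with `P(φ_s) = 0` (`P ∈ ℤ[T]` irreducible of degree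
`e`, `e · 2g = 2d`), a rational global `U ∈ H^{2g}(𝒳(ℂ); ℂ)` with `e_t^*(U|X_t) ∈ W_E(A_t) ⊗ ℂ`, `U|X_t ≠ 0`, and ONE chart `A_{s₀}` of dimension
`(n+1)·g` carrying, for `φ_{s₀}`, a companion tensor structure of a monic `x^{n+1} + Σ a_j x^j` with `n+1` distinct complex roots over an abelian
`g`-fold `T` (`q_j : A_{s₀} ⟶ T` with the companion relations, `u` separating, `σ₀` a section of `q₀` killing the other `q_j`): there ALL of
`W_E(A_{s₀}) ⊗ ℂ` is algebraic (Deligne's Lemma 4.5 in the kernel, `weilClassesField_le_algebraicClasses_of_companion`), so by part R-b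
`W_E(A_s, φ_s) ⊗ ℂ ⊆ Nᵍ(A_s)` for EVERY member `s`. [cite: Deligne1982HodgeCycles, §4 Lemma 4.5 and Remark 4.10]
[cite: MoonenZarhin1998WeilClasses, §1] [cite: Andre1996Motifs, §6.3 Lemme 6.3.3 and Remarque 2 (p. 33)] [cite: Abdulali1994FamiliesAV, Theorem 5.5 (p. 1130)] -/
theorem weilClassesField_le_algebraicClasses_forall_of_lefschetzB_of_companionTensorChart
    (hf : IsCompactAbelianPencil f d) (hB : ∀ ηX : complexBetti 𝒳 2, StandardConjectureBStar (d + 1) 𝒳 ηX)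
    (Φ : 𝒳 ⟶ 𝒳) (hΦ : Φ ≫ f = f)
    (A : ComplexPoints S → AbelianVariety ℂ) (e : ∀ s, (A s).X ≅ fiberOver f s) (φ : ∀ s, A s ⟶ A s)
    (hK : ∀ s, ∃ Φs : fiberOver f s ⟶ fiberOver f s, Φs ≫ fiberι f s = fiberι f s ≫ Φ ∧ (e s).hom ≫ Φs = (φ s).hom.hom.hom ≫ (e s).hom)
    {P : Polynomial ℤ} {eP : ℕ} (hPe : P.natDegree = eP) (hPirr : Irreducible (P.map (Int.castRingHom ℚ)))
    (hP : ∀ s, Polynomial.eval₂ (Int.castRingHom (CategoryTheory.End (A s))) ((φ s : CategoryTheory.End (A s))) P = 0)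
    (her : eP * (2 * g) = 2 * d) (hg : 0 < g)
    (U : complexBetti 𝒳 (2 * g)) (hUQ : IsRationalClass U) {t : ComplexPoints S}
    (hUt : complexBetti.map (e t).hom (2 * g) (complexBetti.map (fiberι f t) (2 * g) U) ∈ weilClassesField (A t) (φ t) P (2 * g))
    (hU0 : complexBetti.map (fiberι f t) (2 * g) U ≠ 0)
    {s₀ : ComplexPoints S} (hT : T.dim = g) (hA₀ : (A s₀).dim = (n + 1) * g)
    {q : Fin (n + 1) → (A s₀ ⟶ T)} {a : Fin (n + 1) → ℤ} {r : Fin (n + 1) → ℂ}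
    (hq0 : φ s₀ ≫ q 0 = -(a 0 • q (Fin.last n)))
    (hqs : ∀ j : Fin n, φ s₀ ≫ q j.succ = q (Fin.castSucc j) - a j.succ • q (Fin.last n))
    {u : A s₀ ⟶ A s₀} (hu : ∀ j : Fin (n + 1), u ≫ q j = (2 ^ (j : ℕ)) • q j)
    {σ₀ : T ⟶ A s₀} (hσ₀ : σ₀ ≫ q 0 = 𝟙 T) (hσ₀' : ∀ j : Fin n, σ₀ ≫ q j.succ = 0)
    (hr : Function.Injective r) (hroot : ∀ k, r k ^ (n + 1) + ∑ j : Fin (n + 1), (a j : ℂ) * r k ^ (j : ℕ) = 0)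
    (s : ComplexPoints S) :
    weilClassesField (A s) (φ s) P (2 * g) ≤ algebraicClasses (A s).X g :=
  weilClassesField_le_algebraicClasses_forall_of_lefschetzB_of_weilClassesField_le_chart hf hB Φ hΦ A e φ hK hPe hPirr hP her hg U hUQ hUt hU0
    (weilClassesField_le_algebraicClasses_of_companion hg hT hA₀ hq0 hqs hu hσ₀ hσ₀' hr hroot P) s

end Tensor

/-! ## §2 The smallest new habitat: quartic CM field, abelian eightfolds, codimension-2 Weil classes -/

section Quartic

variable {T : AbelianVariety ℂ}

/-- **THE QUARTIC HABITAT (fact-free): compact pencils of abelian EIGHTFOLDS with multiplication by a quartic field `E = ℚ(φ)` (`P` irreducible of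
degree 4, `P(φ_s) = 0`), the `E`-Weil classes `⋀⁴_E H¹ ⊂ H⁴` of CODIMENSION 2.** `B⋆` of the ONE 9-fold total space (for every polarization class),
through a chart `A_{s₀} = T ⊗ E` (`T` an abelian SURFACE, companion tensor structure of a monic quartic with 4 distinct roots) and along a
rational global `U` on `W_E(A_t) ⊗ ℂ` non-zero at `t`, ⟹ the codimension-2 `E`-Weil classes of EVERY member eightfold are algebraic:
`weilClassesField (A s) (φ s) P 4 ≤ N²(A_s)`. In print these classes are open even on the split components for `E⁺ ≠ ℚ` (André 2026 §4.4.4).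
[cite: Andre2026, §4.4.4] [cite: Deligne1982HodgeCycles, §4 Lemma 4.5 and Remark 4.10] [cite: MoonenZarhin1998WeilClasses, §1]
[cite: Andre1996Motifs, §6.3 Lemme 6.3.3 and Remarque 2 (p. 33)] -/
theorem weilClassesField_le_algebraicClasses_forall_of_lefschetzB_of_quarticTensorChart
    (hf : IsCompactAbelianPencil f 8) (hB : ∀ ηX : complexBetti 𝒳 2, StandardConjectureBStar 9 𝒳 ηX)
    (Φ : 𝒳 ⟶ 𝒳) (hΦ : Φ ≫ f = f)
    (A : ComplexPoints S → AbelianVariety ℂ) (e : ∀ s, (A s).X ≅ fiberOver f s) (φ : ∀ s, A s ⟶ A s)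
    (hK : ∀ s, ∃ Φs : fiberOver f s ⟶ fiberOver f s, Φs ≫ fiberι f s = fiberι f s ≫ Φ ∧ (e s).hom ≫ Φs = (φ s).hom.hom.hom ≫ (e s).hom)
    {P : Polynomial ℤ} (hPe : P.natDegree = 4) (hPirr : Irreducible (P.map (Int.castRingHom ℚ)))
    (hP : ∀ s, Polynomial.eval₂ (Int.castRingHom (CategoryTheory.End (A s))) ((φ s : CategoryTheory.End (A s))) P = 0)
    (U : complexBetti 𝒳 (2 * 2)) (hUQ : IsRationalClass U) {t : ComplexPoints S}
    (hUt : complexBetti.map (e t).hom (2 * 2) (complexBetti.map (fiberι f t) (2 * 2) U) ∈ weilClassesField (A t) (φ t) P (2 * 2))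
    (hU0 : complexBetti.map (fiberι f t) (2 * 2) U ≠ 0)
    {s₀ : ComplexPoints S} (hT : T.dim = 2) (hA₀ : (A s₀).dim = (3 + 1) * 2)
    {q : Fin (3 + 1) → (A s₀ ⟶ T)} {a : Fin (3 + 1) → ℤ} {r : Fin (3 + 1) → ℂ}
    (hq0 : φ s₀ ≫ q 0 = -(a 0 • q (Fin.last 3)))
    (hqs : ∀ j : Fin 3, φ s₀ ≫ q j.succ = q (Fin.castSucc j) - a j.succ • q (Fin.last 3))
    {u : A s₀ ⟶ A s₀} (hu : ∀ j : Fin (3 + 1), u ≫ q j = (2 ^ (j : ℕ)) • q j)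
    {σ₀ : T ⟶ A s₀} (hσ₀ : σ₀ ≫ q 0 = 𝟙 T) (hσ₀' : ∀ j : Fin 3, σ₀ ≫ q j.succ = 0)
    (hr : Function.Injective r) (hroot : ∀ k, r k ^ (3 + 1) + ∑ j : Fin (3 + 1), (a j : ℂ) * r k ^ (j : ℕ) = 0)
    (s : ComplexPoints S) :
    weilClassesField (A s) (φ s) P (2 * 2) ≤ algebraicClasses (A s).X 2 :=
  weilClassesField_le_algebraicClasses_forall_of_lefschetzB_of_companionTensorChart hf hB Φ hΦ A e φ hK hPe hPirr hP (by norm_num)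
    (by norm_num) U hUQ hUt hU0 hT hA₀ hq0 hqs hu hσ₀ hσ₀' hr hroot s

end Quartic

/-! ## §3 Weil type at the member carrying `U`, the Hodge conjecture at any member -/

section WeilTypeAnchor

/-- **WEIL TYPE AT ONE MEMBER + THE HODGE CONJECTURE AT ANY MEMBER** (parts R-c + R-b §2, fact-free): compact pencil of abelian `d`-folds with
`B⋆(𝒳, η) ∀η`, its global `E`-action (`Φ`, charts with `R(φ_s²) = 0`, `E = ℚ(φ)` a CM field of degree `2e₀`), `(A_t, φ_t)` of Weil type
relative to `E` (`IsWeilTypeCM`, Deligne's `a_σ = k`) with a rational global `U` on `W_E(A_t) ⊗ ℂ`, `U|X_t ≠ 0`, and SOME member `s₀` whose chart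
satisfies the Hodge conjecture ⟹ `W_E(A_s, φ_s) ⊗ ℂ ⊆ Nᵏ(A_s)` for EVERY member (Weil type passes from `t` to `s₀` by part R-c; then part R-b §2).
[cite: Deligne1982HodgeCycles, §4 Prop. 4.4 and proof of Thm. 4.8 (a)] [cite: MoonenZarhin1998WeilClasses, §1 (Criterion)]
[cite: Andre1996Motifs, §6.3 Lemme 6.3.3 and Remarque 2 (p. 33)] [cite: Abdulali1994FamiliesAV, Theorem 5.5 (p. 1130)] -/
theorem weilClassesField_le_algebraicClasses_forall_of_lefschetzB_of_weilTypeCM_of_hodgeConjectureFor_member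
    (hf : IsCompactAbelianPencil f d) (hB : ∀ ηX : complexBetti 𝒳 2, StandardConjectureBStar (d + 1) 𝒳 ηX)
    (Φ : 𝒳 ⟶ 𝒳) (hΦ : Φ ≫ f = f)
    (A : ComplexPoints S → AbelianVariety ℂ) (e : ∀ s, (A s).X ≅ fiberOver f s) (φ : ∀ s, A s ⟶ A s)
    (hK : ∀ s, ∃ Φs : fiberOver f s ⟶ fiberOver f s, Φs ≫ fiberι f s = fiberι f s ≫ Φ ∧ (e s).hom ≫ Φs = (φ s).hom.hom.hom ≫ (e s).hom)
    {R : Polynomial ℤ} {e₀ k : ℕ}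
    (hP : ∀ s, Polynomial.eval₂ (Int.castRingHom (CategoryTheory.End (A s))) ((φ s : CategoryTheory.End (A s)))
      (R.comp (Polynomial.X ^ 2)) = 0)
    (U : complexBetti 𝒳 (2 * k)) (hUQ : IsRationalClass U) {t : ComplexPoints S}
    (hUt : complexBetti.map (e t).hom (2 * k) (complexBetti.map (fiberι f t) (2 * k) U) ∈
      weilClassesField (A t) (φ t) (R.comp (Polynomial.X ^ 2)) (2 * k))
    (hU0 : complexBetti.map (fiberι f t) (2 * k) U ≠ 0) (hWt : IsWeilTypeCM (A t) (φ t) R e₀ k)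
    {s₀ : ComplexPoints S} (hHC₀ : HodgeConjectureFor (A s₀).dim (A s₀).X) (s : ComplexPoints S) :
    weilClassesField (A s) (φ s) (R.comp (Polynomial.X ^ 2)) (2 * k) ≤ algebraicClasses (A s).X k :=
  weilClassesField_le_algebraicClasses_forall_of_lefschetzB_of_hodgeConjectureFor_weilTypeCM_chart hf hB Φ hΦ A e φ hK hP U hUQ hUt hU0
    (isWeilTypeCM_member_of_member hf Φ hΦ A e φ hK hP U hUQ hUt hU0 hWt s₀) hHC₀ s

end WeilTypeAnchor

/-! ## §4 The summit's setting: a CM chart, granted `HC_CM` -/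

section CMAnchor

/-- **THROUGH A CM CHART, GRANTED `HC_CM`** (André's Lemme 6.3.1 pencils; `HC_CM = Theses.RankFourFaces.CMAbelianHodge` a HYPOTHESIS, never a fact):
compact pencil of abelian `d`-folds with `B⋆(𝒳, η) ∀η`, its global `E`-action, `(A_t, φ_t)` of Weil type relative to the CM field `E` with a rational
global `U` on `W_E(A_t) ⊗ ℂ`, `U|X_t ≠ 0`, and ONE chart `A_{s₀}` OF CM TYPE: granted `HC_CM`, `W_E(A_s, φ_s) ⊗ ℂ ⊆ Nᵏ(A_s)` for EVERY member. On
these pencils the André-axis input beyond `HC_CM` is `B⋆` of the one total space, and what it buys is the `E`-Weil classes of every member.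
research route, not a corollary; conditional on HC_CM plus one named minimal statement. [cite: Andre1996Motifs, Lemme 6.3.1 (p. 31) and §6.3 Remarque 2 (p. 33)]
[cite: Deligne1982HodgeCycles, §4 Prop. 4.4 and §5] [cite: MoonenZarhin1998WeilClasses, §1] -/
theorem weilClassesField_le_algebraicClasses_forall_of_lefschetzB_of_HC_CM_of_cmChart (hCM : RankFourFaces.CMAbelianHodge)
    (hf : IsCompactAbelianPencil f d) (hB : ∀ ηX : complexBetti 𝒳 2, StandardConjectureBStar (d + 1) 𝒳 ηX)
    (Φ : 𝒳 ⟶ 𝒳) (hΦ : Φ ≫ f = f)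
    (A : ComplexPoints S → AbelianVariety ℂ) (e : ∀ s, (A s).X ≅ fiberOver f s) (φ : ∀ s, A s ⟶ A s)
    (hK : ∀ s, ∃ Φs : fiberOver f s ⟶ fiberOver f s, Φs ≫ fiberι f s = fiberι f s ≫ Φ ∧ (e s).hom ≫ Φs = (φ s).hom.hom.hom ≫ (e s).hom)
    {R : Polynomial ℤ} {e₀ k : ℕ}
    (hP : ∀ s, Polynomial.eval₂ (Int.castRingHom (CategoryTheory.End (A s))) ((φ s : CategoryTheory.End (A s)))
      (R.comp (Polynomial.X ^ 2)) = 0)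
    (U : complexBetti 𝒳 (2 * k)) (hUQ : IsRationalClass U) {t : ComplexPoints S}
    (hUt : complexBetti.map (e t).hom (2 * k) (complexBetti.map (fiberι f t) (2 * k) U) ∈
      weilClassesField (A t) (φ t) (R.comp (Polynomial.X ^ 2)) (2 * k))
    (hU0 : complexBetti.map (fiberι f t) (2 * k) U ≠ 0) (hWt : IsWeilTypeCM (A t) (φ t) R e₀ k)
    {s₀ : ComplexPoints S} (hcm₀ : IsOfCMType (A s₀)) (s : ComplexPoints S) :
    weilClassesField (A s) (φ s) (R.comp (Polynomial.X ^ 2)) (2 * k) ≤ algebraicClasses (A s).X k :=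
  weilClassesField_le_algebraicClasses_forall_of_lefschetzB_of_weilTypeCM_of_hodgeConjectureFor_member hf hB Φ hΦ A e φ hK hP U hUQ hUt hU0
    hWt (hCM (A s₀) AbelianVariety.isSmoothProjective_holds hcm₀) s

end CMAnchor

end Summit.HodgeConjecture.HodgeConjecture.Ring2.AbelianAll

end
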